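import Literature.Geometry.Riemannian.RicciFlowHeatKernelFn
import Literature.Geometry.Riemannian.NashEntropy
import Mathlib.MeasureTheory.Integral.Average
import HarnessLib

/-!
# A point where the conjugate heat kernel is at least `(4πτ)^{-m/2} e^{-𝒩 - m/2}`
# (Bamler 2020a, proof of Thm. 8.1, display (8.3))

R. Bamler, *Entropy and heat kernel bounds on a Ricci flow background*, arXiv:2008.07093 (2020a),
§8, proof of Thm. 8.1, display (8.3): writing the conjugate heat kernel of a Ricci flow as
`K(x,t;·,s) = (4πτ)^{-m/2} e^{-f}`, `τ = t − s`, the pointed Nash entropy is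
`𝒩 = ∫_M f dν − m/2` for the probability measure `dν = K(x,t;·,s) dg_s`; hence (first-moment
principle) some point `y` has `f(y) ≤ ∫ f dν = 𝒩 + m/2`, i.e.

  `K(x,t;y,s) ≥ (4πτ)^{-m/2} exp(−𝒩 − m/2)`.

* `exists_le_heatKernelFn_of_pointedNashEntropy` — this statement, for the heat kernel function
  `hflow.heatKernelFn hh hR` (`RicciFlowHeatKernelFn.lean`) and the pointed Nash entropy
  `pointedNashEntropy` (`NashEntropy.lean`) of the density flow `(r, v) ↦ K(x,t;v,r)`.

Everything is proved; no definitions, no named facts.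

## References

* R. H. Bamler, *Entropy and heat kernel bounds on a Ricci flow background*, arXiv:2008.07093
  (2020), §5.1 Def. 5.1, §8, proof of Thm. 8.1, (8.3). [Bamler2020Entropy]
-/

noncomputable section

open Set Filter Function MeasureTheory Measure
open scoped Manifold ContDiff Topology ENNReal NNReal

namespace Literature.Geometry.Riemannian

open Lorentzian Lorentzian.PseudoRiemannianMetric

section Kernel

variable {m : ℕ} {H : Type*} [TopologicalSpace H]
  {I : ModelWithCorners ℝ (EuclideanSpace ℝ (Fin m)) H} [I.Boundaryless]
  {M : Type*} [TopologicalSpace M] [ChartedSpace H M] [IsManifold I ∞ M]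
  [T2Space M] [CompactSpace M] [SecondCountableTopology M] [MeasurableSpace M] [BorelSpace M]
  [PreconnectedSpace M]
  {h : ℝ → PseudoRiemannianMetric I ∞ (EuclideanSpace ℝ (Fin m)) (TangentSpace I : M → Type _)}
  {cov : ℝ → CovariantDerivative I (EuclideanSpace ℝ (Fin m)) (TangentSpace I : M → Type _)}
  {a T : ℝ} (hflow : IsRicciFlow h cov (Icc a T)) (hh : IsContMDiffFamilyOn ∞ h univ)
  (hR : ∀ r, (h r).IsRiemannian)

/-- **The pointed Nash entropy of the kernel is a `ν`-expectation**: for `a < s < t ≤ T`,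
`𝒩 = ∫_M f dν_{x,t;s} − m/2` with `f = entropyPotential` of the density flow `(r, v) ↦ K(x,t;v,r)`
at time `s` (Bamler 2020a, Def. 5.1 with `dν = K dg_s`, Def. 1 of §2.3).
[cite: Bamler2020Entropy, §5.1, Def. 5.1] -/
theorem pointedNashEntropy_heatKernelFn_eq_integral_heatKernelMeasure {s t : ℝ} (has : a < s)
    (hst : s < t) (htT : t ≤ T) (x : M) :
    pointedNashEntropy h (fun r' v ↦ hflow.heatKernelFn hh hR t x (v, r')) m t s =
      ∫ y, entropyPotential (fun r' v ↦ hflow.heatKernelFn hh hR t x (v, r')) m t s y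
        ∂(heatKernelMeasure hh hR t x s) - (m : ℝ) / 2 := by
  rw [hflow.integral_heatKernelMeasure_eq_integral_mul_heatKernelFn hh hR ⟨has.trans hst, htT⟩ x
    ⟨has, hst⟩]
  rfl

/-- **A point where the kernel is at least `(4πτ)^{-m/2} e^{-𝒩 - m/2}`** (Bamler 2020a, proof of
Thm. 8.1, display (8.3)): for the conjugate heat kernel `K(x,t;·,s) = (4πτ)^{-m/2} e^{-f}`,
`τ = t − s`, of a Ricci flow on a closed manifold and its pointed Nash entropy
`𝒩 = ∫ f dν − m/2`, `dν = K(x,t;·,s) dg_s` a probability measure, some point `y` has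
`f(y) ≤ 𝒩 + m/2` (first-moment principle), i.e. `K(x,t;y,s) ≥ (4πτ)^{-m/2} exp(−𝒩 − m/2)`.
[cite: Bamler2020Entropy, §8, proof of Thm. 8.1, (8.3)] -/
theorem exists_le_heatKernelFn_of_pointedNashEntropy {s t : ℝ} (has : a < s) (hst : s < t)
    (htT : t ≤ T) (x : M) :
    ∃ y : M, (4 * Real.pi * (t - s)) ^ (-(m : ℝ) / 2) *
        Real.exp (-(pointedNashEntropy h (fun r' v ↦ hflow.heatKernelFn hh hR t x (v, r')) m t s)
          - (m : ℝ) / 2) ≤ hflow.heatKernelFn hh hR t x (y, s) := by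
  have ht : t ∈ Ioc a T := ⟨has.trans hst, htT⟩
  have hs : s ∈ Ioo a t := ⟨has, hst⟩
  have hK0 : ∀ y, 0 < hflow.heatKernelFn hh hR t x (y, s) := fun y ↦
    hflow.heatKernelFn_pos hh hR ht x ⟨mem_univ _, hs⟩
  -- the potential `f = −log K − (m/2) log (4π(t − s))` is continuous, hence `ν`-integrable
  have hfc : Continuous
      (entropyPotential (fun r' v ↦ hflow.heatKernelFn hh hR t x (v, r')) m t s) := by
    show Continuous fun y ↦ -Real.log (hflow.heatKernelFn hh hR t x (y, s)) -
      (m : ℝ) / 2 * Real.log (4 * Real.pi * (t - s))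
    exact ((hflow.continuous_heatKernelFn_slice hh hR ht x hs).log fun y ↦ (hK0 y).ne').neg.sub
      continuous_const
  have hfi : Integrable (entropyPotential (fun r' v ↦ hflow.heatKernelFn hh hR t x (v, r')) m t s)
      (heatKernelMeasure hh hR t x s) :=
    hfc.integrable_of_hasCompactSupport (HasCompactSupport.of_compactSpace _)
  -- first-moment principle for the probability measure `ν_{x,t;s}`
  obtain ⟨y, hy⟩ := exists_le_integral hfi
  refine ⟨y, ?_⟩
  rw [pointedNashEntropy_heatKernelFn_eq_integral_heatKernelMeasure hflow hh hR has hst htT x]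
  have hfy : entropyPotential (fun r' v ↦ hflow.heatKernelFn hh hR t x (v, r')) m t s y =
      -Real.log (hflow.heatKernelFn hh hR t x (y, s)) -
        (m : ℝ) / 2 * Real.log (4 * Real.pi * (t - s)) := rfl
  set N := ∫ z, entropyPotential (fun r' v ↦ hflow.heatKernelFn hh hR t x (v, r')) m t s z
    ∂(heatKernelMeasure hh hR t x s) with hN
  have hc : 0 < 4 * Real.pi * (t - s) := by
    have hπ := Real.pi_pos
    have hτ : 0 < t - s := sub_pos.2 hst
    positivity
  rw [Real.rpow_def_of_pos hc, ← Real.exp_add]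
  calc Real.exp (Real.log (4 * Real.pi * (t - s)) * (-(m : ℝ) / 2) + (-(N - (m : ℝ) / 2) - (m : ℝ) / 2))
      ≤ Real.exp (Real.log (hflow.heatKernelFn hh hR t x (y, s))) := by
        refine Real.exp_le_exp.2 ?_
        rw [hfy] at hy
        linarith [hy]
    _ = hflow.heatKernelFn hh hR t x (y, s) := Real.exp_log (hK0 y)

end Kernel

end Literature.Geometry.Riemannian

end
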